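import Mathlib.Analysis.InnerProductSpace.LinearMap
import Mathlib.Analysis.Normed.Operator.Extend
import Mathlib.RepresentationTheory.Basic
import Mathlib.LinearAlgebra.Finsupp.LinearCombination
import Mathlib.Topology.Algebra.Module.Basic
import HarnessLib

/-!
# Rigidity of cyclic unitary representations: equal diagonal matrix coefficients ⇒ unitarily equivalent

Topic `RepresentationTheory/Unitary`; namespace `Literature.RepresentationTheory.Unitary`.  KERNEL ONLY: theorems; no
definition, no named fact, no record, no `sorry`.

The uniqueness half of the Gelfand–Naimark–Segal construction (Dixmier, *C\*-algebras* §13.1; Folland, *A course in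
abstract harmonic analysis* §3.3; for groups: two cyclic unitary representations whose cyclic vectors have the same
function of positive type `g ↦ ⟪π(g) v, v⟫` are unitarily equivalent, by an equivalence carrying one cyclic vector to the
other).  For a group `G` acting by linear isometries on complex Hilbert spaces `E₁`, `E₂`
(`πᵢ : Representation ℂ G Eᵢ`, `‖πᵢ g x‖ = ‖x‖`) and vectors `v₁`, `v₂`:

* §1 `inner_apply_apply_eq_inner_apply_self` — `⟪π g v, π h v⟫ = ⟪π (h⁻¹ g) v, v⟫`; hence
  `inner_linearCombination_eq` / `norm_linearCombination_eq`: if `⟪π₁ g v₁, v₁⟫ = ⟪π₂ g v₂, v₂⟫` for all `g`, the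
  finite combinations `∑ c_g π₁ g v₁` and `∑ c_g π₂ g v₂` have the same inner products and norms;
* §2 `dense_span_orbit_of_irreducible` — in a topologically irreducible isometric representation every non-zero vector
  is cyclic (the closure of the span of its orbit is a closed invariant subspace);
* §3 **`exists_linearIsometryEquiv_of_inner_apply_eq`** — if moreover `v₁` and `v₂` are CYCLIC (the spans of their orbits
  are dense), there is a unitary `U : E₁ ≃ₗᵢ[ℂ] E₂` with `U v₁ = v₂` and `U (π₁ g x) = π₂ g (U x)` for all `g`, `x`
  (Mathlib's `LinearEquiv.extendOfIsometry` applied to the identity of `G →₀ ℂ` along the two orbit-combination maps,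
  which have the same kernel by §1); **`exists_linearIsometryEquiv_of_irreducible`** — the same for two irreducible
  representations and non-zero vectors with equal diagonal coefficients.

Use: the tree's kernel proof of the uniqueness half of the Stone–von Neumann theorem
(`HeisenbergGroup/StoneVonNeumannUniqueness.lean`): the diagonal coefficient of a lattice-fixed unit vector of a unitary
representation of the `p`-adic Heisenberg group with central character `ψ` is FORCED, so any irreducible one is unitarily
equivalent to the Schrödinger representation on `L²(Fⁿ)`.  Nothing beyond Mathlib is used.

## References
* [Dixmier1977] J. Dixmier, *C\*-algebras*, North-Holland (1977), §13.1 (unitary representations, 13.1.3 equivalence) and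
  Prop. 2.4.1 (uniqueness of the cyclic representation attached to a positive form).
* [Folland1995] G. B. Folland, *A course in abstract harmonic analysis* (1995), §3.3 (functions of positive type and the
  cyclic representations `π_φ`; uniqueness up to unitary equivalence).
-/

set_option autoImplicit false

open scoped InnerProductSpace ComplexConjugate

namespace Literature.RepresentationTheory.Unitary

variable {G : Type*} [Group G]
  {E₁ : Type*} [NormedAddCommGroup E₁] [InnerProductSpace ℂ E₁]
  {E₂ : Type*} [NormedAddCommGroup E₂] [InnerProductSpace ℂ E₂]

/-! ## §1 Matrix coefficients of orbit combinations -/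

section Coefficients

variable {E : Type*} [NormedAddCommGroup E] [InnerProductSpace ℂ E] (π : Representation ℂ G E)

/-- an operator preserving norms is continuous. [cite: Dixmier1977, §13.1.1] -/
theorem continuous_apply_of_norm_apply_eq (hπ : ∀ (g : G) (x : E), ‖π g x‖ = ‖x‖) (g : G) : Continuous (π g) :=
  AddMonoidHomClass.continuous_of_bound (π g) 1 fun x => by rw [hπ, one_mul]

/-- an operator of an isometric representation preserves inner products (polarisation). [cite: Dixmier1977, §13.1.1] -/
theorem inner_apply_apply (hπ : ∀ (g : G) (x : E), ‖π g x‖ = ‖x‖) (g : G) (x y : E) : ⟪π g x, π g y⟫_ℂ = ⟪x, y⟫_ℂ :=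
  (LinearMap.norm_map_iff_inner_map_map (π g)).1 (hπ g) x y

/-- **`⟪π g v, π h v⟫ = ⟪π (h⁻¹ g) v, v⟫`** for an isometric representation (apply the isometry `π h⁻¹`).
[cite: Folland1995, §3.3] -/
theorem inner_apply_apply_eq_inner_apply_self (hπ : ∀ (g : G) (x : E), ‖π g x‖ = ‖x‖) (g h : G) (v : E) :
    ⟪π g v, π h v⟫_ℂ = ⟪π (h⁻¹ * g) v, v⟫_ℂ := by
  rw [← inner_apply_apply π hπ h⁻¹ (π g v) (π h v), ← Module.End.mul_apply, ← map_mul, ← Module.End.mul_apply,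
    ← map_mul, inv_mul_cancel, map_one, Module.End.one_apply]

/-- the orbit-combination `∑ c_g • π g v` of a finitely supported `c : G →₀ ℂ`, as a sum over the support. [cite: Folland1995, §3.3] -/
theorem linearCombination_orbit_apply (v : E) (c : G →₀ ℂ) :
    Finsupp.linearCombination ℂ (fun g => π g v) c = ∑ g ∈ c.support, c g • π g v :=
  Finsupp.linearCombination_apply _ _

end Coefficients

variable (π₁ : Representation ℂ G E₁) (π₂ : Representation ℂ G E₂)

/-- **equal diagonal coefficients ⇒ equal Gram matrices**: if `⟪π₁ g v₁, v₁⟫ = ⟪π₂ g v₂, v₂⟫` for all `g` (two cyclic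
vectors with the same function of positive type), then all inner products of orbit combinations agree:
`⟪∑ c_g π₁ g v₁, ∑ d_h π₁ h v₁⟫ = ⟪∑ c_g π₂ g v₂, ∑ d_h π₂ h v₂⟫`. [cite: Folland1995, §3.3] -/
theorem inner_linearCombination_eq (hπ₁ : ∀ (g : G) (x : E₁), ‖π₁ g x‖ = ‖x‖)
    (hπ₂ : ∀ (g : G) (x : E₂), ‖π₂ g x‖ = ‖x‖) {v₁ : E₁} {v₂ : E₂}
    (hcoef : ∀ g, ⟪π₁ g v₁, v₁⟫_ℂ = ⟪π₂ g v₂, v₂⟫_ℂ) (c d : G →₀ ℂ) :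
    ⟪Finsupp.linearCombination ℂ (fun g => π₁ g v₁) c, Finsupp.linearCombination ℂ (fun g => π₁ g v₁) d⟫_ℂ =
      ⟪Finsupp.linearCombination ℂ (fun g => π₂ g v₂) c, Finsupp.linearCombination ℂ (fun g => π₂ g v₂) d⟫_ℂ := by
  simp only [linearCombination_orbit_apply, sum_inner, inner_sum, inner_smul_left, inner_smul_right,
    inner_apply_apply_eq_inner_apply_self π₁ hπ₁, inner_apply_apply_eq_inner_apply_self π₂ hπ₂, hcoef]

/-- **equal diagonal coefficients ⇒ equal norms of orbit combinations**: `‖∑ c_g π₁ g v₁‖ = ‖∑ c_g π₂ g v₂‖`.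
[cite: Folland1995, §3.3] -/
theorem norm_linearCombination_eq (hπ₁ : ∀ (g : G) (x : E₁), ‖π₁ g x‖ = ‖x‖)
    (hπ₂ : ∀ (g : G) (x : E₂), ‖π₂ g x‖ = ‖x‖) {v₁ : E₁} {v₂ : E₂}
    (hcoef : ∀ g, ⟪π₁ g v₁, v₁⟫_ℂ = ⟪π₂ g v₂, v₂⟫_ℂ) (c : G →₀ ℂ) :
    ‖Finsupp.linearCombination ℂ (fun g => π₁ g v₁) c‖ = ‖Finsupp.linearCombination ℂ (fun g => π₂ g v₂) c‖ := by
  rw [norm_eq_sqrt_re_inner (𝕜 := ℂ), norm_eq_sqrt_re_inner (𝕜 := ℂ) (Finsupp.linearCombination ℂ _ c),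
    inner_linearCombination_eq π₁ π₂ hπ₁ hπ₂ hcoef]

/-- the operators of a representation permute the orbit combinations: `π g (∑ c_h π h v) = ∑ c_h π (g h) v`, i.e. the
combination of `c` transported along `h ↦ g h`. [cite: Folland1995, §3.3] -/
theorem apply_linearCombination_orbit {E : Type*} [NormedAddCommGroup E] [InnerProductSpace ℂ E]
    (π : Representation ℂ G E) (v : E) (g : G) (c : G →₀ ℂ) :
    π g (Finsupp.linearCombination ℂ (fun h => π h v) c) =
      Finsupp.linearCombination ℂ (fun h => π h v) (Finsupp.mapDomain (g * ·) c) := by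
  have e : (⇑(π g) ∘ fun h => π h v) = ((fun h => π h v) ∘ fun h => g * h) := by
    funext h
    simp only [Function.comp_apply, map_mul, Module.End.mul_apply]
  rw [Finsupp.linearCombination_mapDomain, LinearMap.map_finsupp_linearCombination, e]

/-! ## §2 Irreducible ⇒ every non-zero vector is cyclic -/

/-- the span of an orbit is invariant. [cite: Dixmier1977, §13.1.1] -/
theorem apply_mem_span_orbit {E : Type*} [NormedAddCommGroup E] [InnerProductSpace ℂ E] (π : Representation ℂ G E)
    (v : E) (g : G) {x : E} (hx : x ∈ Submodule.span ℂ (Set.range fun h => π h v)) :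
    π g x ∈ Submodule.span ℂ (Set.range fun h => π h v) := by
  have hle : (Submodule.span ℂ (Set.range fun h => π h v)).map (π g) ≤ Submodule.span ℂ (Set.range fun h => π h v) := by
    rw [Submodule.map_span, Submodule.span_le]
    rintro _ ⟨_, ⟨h, rfl⟩, rfl⟩
    refine Submodule.subset_span ⟨g * h, ?_⟩
    simp only [map_mul, Module.End.mul_apply]
  exact hle (Submodule.mem_map_of_mem hx)

/-- **in a topologically irreducible isometric representation every non-zero vector is cyclic**: if the closed invariant
subspaces are `⊥` and `⊤` only and `v ≠ 0`, the span of the orbit `π(G) v` is dense ("a representation is irreducible iff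
every non-zero vector is cyclic"). [cite: Dixmier1977, §13.1.1] -/
theorem dense_span_orbit_of_irreducible {E : Type*} [NormedAddCommGroup E] [InnerProductSpace ℂ E]
    (π : Representation ℂ G E) (hπ : ∀ (g : G) (x : E), ‖π g x‖ = ‖x‖)
    (hirr : ∀ K : Submodule ℂ E, IsClosed (K : Set E) → (∀ (g : G), ∀ x ∈ K, π g x ∈ K) → K = ⊥ ∨ K = ⊤)
    {v : E} (hv : v ≠ 0) : Dense (Submodule.span ℂ (Set.range fun g => π g v) : Set E) := by
  set M := Submodule.span ℂ (Set.range fun g => π g v) with hM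
  rw [Submodule.dense_iff_topologicalClosure_eq_top]
  have hvM : v ∈ M := Submodule.subset_span ⟨1, by simp only [map_one, Module.End.one_apply]⟩
  -- invariance of the closure: `π g` is continuous and preserves `M`
  have hinv : ∀ (g : G), ∀ x ∈ M.topologicalClosure, π g x ∈ M.topologicalClosure := by
    intro g x hx
    rw [← SetLike.mem_coe, Submodule.topologicalClosure_coe] at hx ⊢
    exact closure_mono (Set.image_subset_iff.2 fun y hy => apply_mem_span_orbit π v g hy)
      (image_closure_subset_closure_image (continuous_apply_of_norm_apply_eq π hπ g) ⟨x, hx, rfl⟩)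
  rcases hirr M.topologicalClosure M.isClosed_topologicalClosure hinv with h | h
  · exfalso
    have : v ∈ (⊥ : Submodule ℂ E) := h ▸ M.le_topologicalClosure hvM
    exact hv ((Submodule.mem_bot ℂ).1 this)
  · exact h

/-! ## §3 The unitary equivalence -/

variable [CompleteSpace E₁] [CompleteSpace E₂]

/-- **rigidity of cyclic representations (uniqueness of the GNS representation).**  Two representations of `G` by linear
isometries on complex Hilbert spaces with CYCLIC vectors `v₁`, `v₂` having the same diagonal coefficient
`⟪π₁ g v₁, v₁⟫ = ⟪π₂ g v₂, v₂⟫` are unitarily equivalent by a (unique) unitary `U` with `U v₁ = v₂`: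
`U (π₁ g x) = π₂ g (U x)`.  Construction: `U (∑ c_g π₁ g v₁) := ∑ c_g π₂ g v₂` is well defined and isometric by
`norm_linearCombination_eq`, and extends to the closures (Mathlib `LinearEquiv.extendOfIsometry`).
[cite: Dixmier1977, Prop. 2.4.1 (ii) & §13.1.3] -/
theorem exists_linearIsometryEquiv_of_inner_apply_eq (hπ₁ : ∀ (g : G) (x : E₁), ‖π₁ g x‖ = ‖x‖)
    (hπ₂ : ∀ (g : G) (x : E₂), ‖π₂ g x‖ = ‖x‖) {v₁ : E₁} {v₂ : E₂}
    (hcoef : ∀ g, ⟪π₁ g v₁, v₁⟫_ℂ = ⟪π₂ g v₂, v₂⟫_ℂ)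
    (hd₁ : Dense (Submodule.span ℂ (Set.range fun g => π₁ g v₁) : Set E₁))
    (hd₂ : Dense (Submodule.span ℂ (Set.range fun g => π₂ g v₂) : Set E₂)) :
    ∃ U : E₁ ≃ₗᵢ[ℂ] E₂, U v₁ = v₂ ∧ ∀ (g : G) (x : E₁), U (π₁ g x) = π₂ g (U x) := by
  set Φ₁ : (G →₀ ℂ) →ₗ[ℂ] E₁ := Finsupp.linearCombination ℂ (fun g => π₁ g v₁) with hΦ₁
  set Φ₂ : (G →₀ ℂ) →ₗ[ℂ] E₂ := Finsupp.linearCombination ℂ (fun g => π₂ g v₂) with hΦ₂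
  have hr₁ : DenseRange Φ₁ := by
    show Dense (Set.range Φ₁)
    rw [← LinearMap.coe_range, hΦ₁, Finsupp.range_linearCombination]
    exact hd₁
  have hr₂ : DenseRange Φ₂ := by
    show Dense (Set.range Φ₂)
    rw [← LinearMap.coe_range, hΦ₂, Finsupp.range_linearCombination]
    exact hd₂
  have hnorm : ∀ c : G →₀ ℂ, ‖Φ₂ (LinearEquiv.refl ℂ (G →₀ ℂ) c)‖ = ‖Φ₁ c‖ := fun c =>
    (norm_linearCombination_eq π₁ π₂ hπ₁ hπ₂ hcoef c).symm
  set U : E₁ ≃ₗᵢ[ℂ] E₂ := (LinearEquiv.refl ℂ (G →₀ ℂ)).extendOfIsometry Φ₁ Φ₂ hr₁ hr₂ hnorm with hU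
  have hUΦ : ∀ c, U (Φ₁ c) = Φ₂ c := fun c => LinearEquiv.extendOfIsometry_eq _ _ _ hr₁ hr₂ hnorm c
  have hsingle : ∀ g, U (π₁ g v₁) = π₂ g v₂ := by
    intro g
    have h := hUΦ (Finsupp.single g 1)
    simp only [hΦ₁, hΦ₂, Finsupp.linearCombination_single, one_smul] at h
    exact h
  refine ⟨U, ?_, fun g => ?_⟩
  · have h := hsingle 1
    rwa [map_one, map_one, Module.End.one_apply, Module.End.one_apply] at h
  · -- both sides are continuous in `x` and agree on the dense range of `Φ₁`
    refine fun x => congrFun (hr₁.equalizer (U.continuous.comp (continuous_apply_of_norm_apply_eq π₁ hπ₁ g))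
      ((continuous_apply_of_norm_apply_eq π₂ hπ₂ g).comp U.continuous) ?_) x
    funext c
    simp only [Function.comp_apply]
    rw [apply_linearCombination_orbit, hUΦ, hUΦ, apply_linearCombination_orbit]

/-- **two irreducible isometric representations with non-zero vectors of equal diagonal coefficient are unitarily
equivalent** (irreducible ⇒ cyclic, §2, then `exists_linearIsometryEquiv_of_inner_apply_eq`).
[cite: Dixmier1977, Prop. 2.4.1 (ii) & §13.1.3] -/
theorem exists_linearIsometryEquiv_of_irreducible (hπ₁ : ∀ (g : G) (x : E₁), ‖π₁ g x‖ = ‖x‖)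
    (hπ₂ : ∀ (g : G) (x : E₂), ‖π₂ g x‖ = ‖x‖)
    (hirr₁ : ∀ K : Submodule ℂ E₁, IsClosed (K : Set E₁) → (∀ (g : G), ∀ x ∈ K, π₁ g x ∈ K) → K = ⊥ ∨ K = ⊤)
    (hirr₂ : ∀ K : Submodule ℂ E₂, IsClosed (K : Set E₂) → (∀ (g : G), ∀ x ∈ K, π₂ g x ∈ K) → K = ⊥ ∨ K = ⊤)
    {v₁ : E₁} {v₂ : E₂} (hv₁ : v₁ ≠ 0) (hv₂ : v₂ ≠ 0) (hcoef : ∀ g, ⟪π₁ g v₁, v₁⟫_ℂ = ⟪π₂ g v₂, v₂⟫_ℂ) :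
    ∃ U : E₁ ≃ₗᵢ[ℂ] E₂, U v₁ = v₂ ∧ ∀ (g : G) (x : E₁), U (π₁ g x) = π₂ g (U x) :=
  exists_linearIsometryEquiv_of_inner_apply_eq π₁ π₂ hπ₁ hπ₂ hcoef
    (dense_span_orbit_of_irreducible π₁ hπ₁ hirr₁ hv₁) (dense_span_orbit_of_irreducible π₂ hπ₂ hirr₂ hv₂)

end Literature.RepresentationTheory.Unitary
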